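import Mathlib
import Summits.Ventures.PercRepro2.Defs
import Summits.Ventures.PercRepro2.Harris
import Summits.Ventures.PercRepro2.Switching

/-!
# Edge induction for quadratic inequalities `P(F)P(G) ≥ P(H)P(K)` (blind cell PercRepro2, mine-1)

The slack `P_p(F)P_p(G) − P_p(H)P_p(K)` is a polynomial of degree ≤ 2 in every single weight
`p e` (pinning identity).  Writing it in the Bernstein basis of `p e`,

  `slack p = (p e)² · slack p[e↦1] + p e (1 − p e) · crossTerm p e + (1 − p e)² · slack p[e↦0]`,

it follows by induction on the set of non-pinned edges that the inequality holds for every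
admissible weight vector as soon as (i) it holds for every 0/1-valued vector (which is a pure
event inclusion `H ∩ K ⊆ F ∩ G`) and (ii) the cross term is nonnegative for every pinned vector
(`R13-STATEMENT.md`, Lemma 2.4).  This is the algebraic step «XT′(e) for all pinned
specialisations ⇒ the inequality for all `p`»; it is independent of the particular events and is
specialised to mine-1's row R13 at the end.
-/

namespace Summit.Ventures.PercRepro2

section EdgeInduction

variable {E : Type*} [Fintype E] [DecidableEq E] {R : Type*} [CommRing R]

/-- The quadratic slack `P(F)P(G) − P(H)P(K)`. -/
noncomputable def slack (p : E → R) (F G H K : Set (Config E)) : R :=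
  prob p F * prob p G - prob p H * prob p K

/-- The cross term of the slack at the edge `e`:
`P₁(F)P₀(G) + P₀(F)P₁(G) − P₁(H)P₀(K) − P₀(H)P₁(K)` with `Pᵢ = P_{p[e↦i]}`. -/
noncomputable def crossTerm (p : E → R) (e : E) (F G H K : Set (Config E)) : R :=
  prob (Function.update p e 1) F * prob (Function.update p e 0) G
    + prob (Function.update p e 0) F * prob (Function.update p e 1) G
    - prob (Function.update p e 1) H * prob (Function.update p e 0) K
    - prob (Function.update p e 0) H * prob (Function.update p e 1) K

/-- **Quadratic (Bernstein) expansion of the slack in the weight of one edge.** -/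
lemma slack_eq_pin (p : E → R) (e : E) (F G H K : Set (Config E)) :
    slack p F G H K = p e ^ 2 * slack (Function.update p e 1) F G H K
      + p e * (1 - p e) * crossTerm p e F G H K
      + (1 - p e) ^ 2 * slack (Function.update p e 0) F G H K := by
  unfold slack crossTerm
  rw [prob_eq_pin p F e, prob_eq_pin p G e, prob_eq_pin p H e, prob_eq_pin p K e]
  ring

/-- A 0/1-valued (deterministic) weight vector. -/
def IsDet (q : E → R) : Prop := ∀ e, q e = 0 ∨ q e = 1

open Classical in
/-- The configuration selected by a deterministic weight vector: `e` is open iff `q e = 1`. -/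
noncomputable def detConfig (q : E → R) : Config E := fun e => if q e = 1 then true else false

variable [Nontrivial R]

omit [DecidableEq E] in
/-- Under a deterministic weight vector the weight is the indicator of `detConfig q`. -/
lemma weight_of_isDet {q : E → R} (hq : IsDet q) (ω : Config E) :
    weight q ω = if ω = detConfig q then 1 else 0 := by
  classical
  unfold weight
  by_cases h : ω = detConfig q
  · rw [if_pos h]
    refine Finset.prod_eq_one fun e _ => ?_
    subst h
    rcases hq e with h0 | h1
    · have : detConfig q e = false := by simp [detConfig, h0]
      rw [this, h0]; simp [edgeFactor]
    · have : detConfig q e = true := by simp [detConfig, h1]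
      rw [this, h1]; simp [edgeFactor]
  · rw [if_neg h]
    obtain ⟨e, he⟩ : ∃ e, ω e ≠ detConfig q e := by
      by_contra hc
      exact h (funext fun e => by_contra fun hne => hc ⟨e, hne⟩)
    refine Finset.prod_eq_zero (Finset.mem_univ e) ?_
    rcases hq e with h0 | h1
    · have hd : detConfig q e = false := by simp [detConfig, h0]
      rw [hd] at he
      have : ω e = true := by cases hω : ω e <;> simp_all
      rw [h0, this]; simp [edgeFactor]
    · have hd : detConfig q e = true := by simp [detConfig, h1]
      rw [hd] at he
      have : ω e = false := by cases hω : ω e <;> simp_all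
      rw [h1, this]; simp [edgeFactor]

open Classical in
/-- Under a deterministic weight vector, `prob q A` is the indicator of `detConfig q ∈ A`. -/
lemma prob_of_isDet {q : E → R} (hq : IsDet q) (A : Set (Config E)) :
    prob q A = if detConfig q ∈ A then 1 else 0 := by
  unfold prob
  rw [Finset.sum_eq_single (detConfig q)]
  · by_cases hA : detConfig q ∈ A <;> simp [Set.indicator, hA, weight_of_isDet hq]
  · intro ω _ hne
    simp [Set.indicator, weight_of_isDet hq, hne]
  · intro h; exact absurd (Finset.mem_univ _) h

variable [PartialOrder R] [IsOrderedRing R]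

open Classical in
/-- Base case: for a deterministic vector the slack is nonnegative as soon as `H ∩ K ⊆ F ∩ G`. -/
lemma slack_nonneg_of_isDet {q : E → R} (hq : IsDet q) {F G H K : Set (Config E)}
    (hHK : H ∩ K ⊆ F ∩ G) : 0 ≤ slack q F G H K := by
  unfold slack
  rw [prob_of_isDet hq, prob_of_isDet hq, prob_of_isDet hq, prob_of_isDet hq]
  by_cases hH : detConfig q ∈ H
  · by_cases hK : detConfig q ∈ K
    · have hFG := hHK ⟨hH, hK⟩
      simp [hH, hK, hFG.1, hFG.2]
    · by_cases hF : detConfig q ∈ F <;> by_cases hG : detConfig q ∈ G <;> simp [hH, hK, hF, hG]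
  · by_cases hF : detConfig q ∈ F <;> by_cases hG : detConfig q ∈ G <;> simp [hH, hF, hG]

omit [Fintype E] [DecidableEq E] [PartialOrder R] [IsOrderedRing R] [Nontrivial R] in
/-- `q` is obtained from `p` by pinning every edge outside `S` to `0` or `1`. -/
def IsPinnedOn (p q : E → R) (S : Finset E) : Prop :=
  (∀ e ∈ S, q e = p e) ∧ ∀ e, e ∉ S → q e = 0 ∨ q e = 1

omit [Fintype E] [PartialOrder R] [IsOrderedRing R] [Nontrivial R] in
/-- Pinning one more edge of a pinned vector to `0` or `1` keeps it pinned (on the smaller set). -/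
lemma isPinnedOn_update {p q : E → R} {S : Finset E} {e : E}
    (h : IsPinnedOn p q (insert e S)) (he : e ∉ S) (v : R) (hv : v = 0 ∨ v = 1) :
    IsPinnedOn p (Function.update q e v) S := by
  refine ⟨fun f hf => ?_, fun f hf => ?_⟩
  · have hfe : f ≠ e := fun hfe => he (hfe ▸ hf)
    rw [Function.update_of_ne hfe]
    exact h.1 f (Finset.mem_insert_of_mem hf)
  · by_cases hfe : f = e
    · subst hfe
      rw [Function.update_self]
      exact hv
    · rw [Function.update_of_ne hfe]
      exact h.2 f fun hm => hf ((Finset.mem_insert.1 hm).resolve_left hfe)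

/-- **Edge induction.** If `H ∩ K ⊆ F ∩ G` and the cross term is nonnegative for every vector
obtained from `p` by pinning some edges to `0`/`1` (at every still-free edge), then
`P_p(F)P_p(G) ≥ P_p(H)P_p(K)` for every admissible `p`. -/
theorem slack_nonneg_of_crossTerm (p : E → R) (hp : IsProbVec p) (F G H K : Set (Config E))
    (hHK : H ∩ K ⊆ F ∩ G)
    (hX : ∀ (q : E → R) (S : Finset E), IsPinnedOn p q S → ∀ e ∈ S, 0 ≤ crossTerm q e F G H K) :
    0 ≤ slack p F G H K := by
  suffices key : ∀ (S : Finset E) (q : E → R), IsPinnedOn p q S → 0 ≤ slack q F G H K by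
    exact key Finset.univ p ⟨fun _ _ => rfl, fun e he => absurd (Finset.mem_univ e) he⟩
  intro S
  induction S using Finset.induction_on with
  | empty =>
    intro q hq
    exact slack_nonneg_of_isDet (fun e => hq.2 e (Finset.notMem_empty e)) hHK
  | insert e S he ih =>
    intro q hq
    have h1 := ih _ (isPinnedOn_update hq he 1 (Or.inr rfl))
    have h0 := ih _ (isPinnedOn_update hq he 0 (Or.inl rfl))
    have hx := hX q (insert e S) hq e (Finset.mem_insert_self e S)
    have hqe : q e = p e := hq.1 e (Finset.mem_insert_self e S)
    have h0le : 0 ≤ q e := hqe ▸ hp.nonneg e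
    have hle1 : 0 ≤ 1 - q e := sub_nonneg.2 (hqe ▸ hp.le_one e)
    rw [slack_eq_pin q e]
    exact add_nonneg (add_nonneg (mul_nonneg (pow_nonneg h0le 2) h1)
      (mul_nonneg (mul_nonneg h0le hle1) hx)) (mul_nonneg (pow_nonneg hle1 2) h0)

end EdgeInduction

section R13Induction

variable {V : Type*} {E : Type*} [Fintype E] [DecidableEq E] {R : Type*} [CommRing R]
  [PartialOrder R] [IsOrderedRing R] [Nontrivial R]

/-- The cross term XT′(e) of row R13 (`R13-STATEMENT.md` Lemma 2.4):
`P₁(A∩C)P₀(B∩C) + P₀(A∩C)P₁(B∩C) − P₁((A∘B)∩C)P₀(C) − P₀((A∘B)∩C)P₁(C) ≥ 0`. -/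
def R13CrossTerm (p : E → R) (e : E) (ends : E → Sym2 V) (s t a b : V) : Prop :=
  0 ≤ crossTerm p e (connEvent ends s a ∩ connEvent ends s t)
    (connEvent ends s b ∩ connEvent ends s t)
    (disjointConnEvent ends s a b ∩ connEvent ends s t) (connEvent ends s t)

/-- **R13 from its cross terms**: if XT′(e) holds at every free edge of every vector obtained from
`p` by pinning edges to `0`/`1`, then `R13 p ends s t a b`. -/
theorem R13_of_crossTerm (p : E → R) (hp : IsProbVec p) (ends : E → Sym2 V) (s t a b : V)
    (hX : ∀ (q : E → R) (S : Finset E), IsPinnedOn p q S → ∀ e ∈ S, R13CrossTerm q e ends s t a b) :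
    R13 p ends s t a b := by
  have h := slack_nonneg_of_crossTerm p hp (connEvent ends s a ∩ connEvent ends s t)
    (connEvent ends s b ∩ connEvent ends s t)
    (disjointConnEvent ends s a b ∩ connEvent ends s t) (connEvent ends s t)
    (fun ω hω => by
      obtain ⟨⟨hd, hc⟩, _⟩ := hω
      have hab := disjointConnEvent_subset ends s a b hd
      exact ⟨⟨hab.1, hc⟩, ⟨hab.2, hc⟩⟩)
    hX
  unfold slack at h
  exact sub_nonneg.1 h

end R13Induction

end Summit.Ventures.PercRepro2
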